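import Summits.BirchSwinnertonDyer.BirchSwinnertonDyer.Theorems.Rank2Observatory2DescClRowCertLe
import Summits.BirchSwinnertonDyer.BirchSwinnertonDyer.Theorems.Rank2Observatory2DescKillList
import HarnessLib

/-!
# BirchSwinnertonDyer — rank ≥ 2 observatory: KERNEL-2DESC-CL v2.5 — the class-group-general row certificate WITH A KILL LIST (`checkLeK r`, tier 1: `8` admissible classes, one killed ⇒ `rank E(ℚ) ≤ 2`)

HONEST FRAMING: per-curve certified theorems and census instruments; no claim on BSD in rank ≥ 2.

Generic addendum of the reflective class-group-general kernel 2-descent (cell `b2b-bsdr2`, seat cert-1;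
design `b2b-bsdr2-cert-1/KERNEL-2DESC-CL.md` §8). The `r`-checker `TwoDescCl.checkLe r fc cc`
(`Rank2Observatory2DescClRowCertLe`) bounds the rank by COUNTING the classes `U ⊆ family` that pass the
sieve `adm fc cc` (square residues of the norm, real sign, valuation parity at `W₁, W₂`): `#adm < 2^(r+1) ⇒
rank E(ℚ) ≤ r`. On the cert-1 census `22 941` even-class-number rows have exactly `8` admissible classes
(`dim = 3`), so `checkLe 2` rejects them although `rank E(ℚ) = 2` is expected: one of the `4` non-image
classes must be removed by a finer local argument. This file ports the cert-3 KILL layer (landed generics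
`Rank2Observatory2DescKillCheck` — the integer residue-insolubility search `killCheck` for the pair of
quadrics of a class — and `Rank2Observatory2DescKillList` — `KillEntry`, `killListCheck`, `admKills`,
`admKills_sound`) to the class-group-general records:
* `ClKill` — a raw killed class (indices `U` into `fam fc cc`, prime `p ∈ killPrimes`, search fuel) and
  `ClKill.toEntry` — its `KillEntry 0 n` whose representative coordinates `z = ∏_{j∈U} g_j` are COMPUTED
  from the family coordinates `famCoords` (so the product clause of `killListCheck` holds by evaluation);
* `checkLeK r fc cc ks` — the clauses of `checkLe r fc cc` except the count (byte-identical), then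
  `killListCheck` of the kill list, "no killed class is trivial", and `#(admKills (adm fc cc) kills) < 2^(r+1)`;
* `rank_le_of_checkLeK_cl` — soundness (`rank E(ℚ) ≤ r`): the proof of `rank_le_of_checkLe_cl` verbatim up
  to the sieve, then `admKills_sound` (a killed class met by a rational point would make `(x − θ_E)·z` a
  square in `K`, excluded by `not_isSquare_of_killCheck`) and the strict-count cover theorem
  `mordellWeilRank_le_of_coverSet_cl_lt` with the sieve `admKills (adm fc cc) kills`;
* the `K`-free wrappers `rank_eq_of_certsLeK` / `rank_eq_of_certsLeK_complSq` over `CubicField a b c` with a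
  tree lower bound `r ≤ rank` (shape of every sharded v2.5 row:
  `<field thm> ⟨curve literal⟩ [⟨U, p, fuel⟩] (by decide +kernel) KernelCerts<k>.C<label>.two_le_rank`).
With `ks = []` the checker is `checkLe` plus two trivially true clauses (kernel sanity checks at the end on
the landed `4528a1` records: `checkLeK 2 … [] = true`, `checkLeK 1 … [] = false`).
Kill data are found by the cert-3 search `killsearch.py` (byte-identical reuse) inside the cert-1 kit job and
re-verified by an exact Python mirror of `killCheck` in the emitter before any row is written; the kernel
re-verifies everything by `decide`.
Sorry-free; axioms `propext`, `Classical.choice`, `Quot.sound`.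
[cite: Cassels1991LecturesEllipticCurves, §15] [cite: CremonaAlgorithms1997, §3.6] [cite: Cohen1993, §4.8.2, §6.5]
-/

set_option linter.dupNamespace false

noncomputable section

open scoped NumberField nonZeroDivisors

open Literature.NumberTheory.NumberFields Polynomial Module NumberField IsDedekindDomain Ideal

namespace Summit.BirchSwinnertonDyer.BirchSwinnertonDyer.Rank2Observatory.TwoDescCl

open TwoDescCubic ClFieldCert

/-! ## Kill records over the class-group-general family -/

/-- One killed class of a class-group-general row, raw form: indices `U` into the family `fam fc cc`
(there is no separate unit part: the units are family members), the prime `p ∈ killPrimes` of the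
residue-insolubility search and its fuel (`depth − 1`). [folklore] -/
structure ClKill where
  /-- the class (indices into `fam fc cc`) -/
  U : List ℕ
  /-- the kill prime -/
  p : ℕ
  /-- search fuel of `killCheck` -/
  fuel : ℕ

/-- Power-basis coordinates of the family members, as a `Fin`-family. [folklore] -/
def famCoords (fc : ClFieldCert) (cc : ClCurveCert) : Fin (fam fc cc).length → ℤ × ℤ × ℤ :=
  fun j => ((fam fc cc).get j).2.2.g

/-- The empty unit-coordinate family (the class-group-general format lists no separate units). [folklore] -/
def noUnitCoords : Fin 0 → ℤ × ℤ × ℤ := fun i => i.elim0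

/-- A raw kill as a `KillEntry` over the family coordinates (the representative's coordinates
`z = ∏_{j ∈ U} g_j` are computed here, so `killListCheck`'s product clause holds by evaluation). [folklore] -/
def ClKill.toEntry (fc : ClFieldCert) (cc : ClCurveCert) (k : ClKill) : KillEntry 0 (fam fc cc).length :=
  ⟨∅, Finset.univ.filter fun j : Fin (fam fc cc).length => j.val ∈ k.U,
    prodCoords fc.a fc.b fc.c noUnitCoords (famCoords fc cc) ∅
      (Finset.univ.filter fun j : Fin (fam fc cc).length => j.val ∈ k.U), k.p, k.fuel⟩

/-- The kill list of a row as `KillEntry`s. [folklore] -/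
def killEntriesCl (fc : ClFieldCert) (cc : ClCurveCert) (ks : List ClKill) :
    List (KillEntry 0 (fam fc cc).length) :=
  ks.map (ClKill.toEntry fc cc)

/-- The sieve of a v2.5 row: `adm fc cc` (residues, sign, valuation parity at `W₁, W₂`) minus the killed
classes. [folklore] -/
def admK (fc : ClFieldCert) (cc : ClCurveCert) (ks : List ClKill) :
    Finset (Fin 0) → Finset (Fin (fam fc cc).length) → Bool :=
  admKills (adm fc cc) (killEntriesCl fc cc ks)

/-! ## The `r`-checker with a kill list -/

/-- **The per-curve checker with a kill list**: the clauses of `checkLe r fc cc` except its count (`Δ ≠ 0`;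
`F` has no root mod `pF`; `F(t) = 0`, `F′(t) = D`; `Δ(F) < 0`; `N D ≠ 0` and `|N D| = ∏ p^e` against registry
rows; the codes of `supp D`; `D ∉ W₁, W₂`; `Q > 0`; `famCheck` of the whole family; the parity certificate),
then the kill-list certificate `killListCheck` (each killed class: `p ∈ killPrimes`, coordinates multiply
out, `z ≠ 0`, `killCheck` succeeds), no killed class is the trivial class, and FEWER THAN `2^(r+1)` classes
pass `admK`. Computable; run by `decide +kernel`.
[cite: Cassels1991LecturesEllipticCurves, §15] [cite: CremonaAlgorithms1997, §3.6] -/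
def checkLeK (r : ℕ) (fc : ClFieldCert) (cc : ClCurveCert) (ks : List ClKill) : Bool :=
  decide (deltaShort cc.A cc.B cc.C ≠ 0) &&
    noRootMod cc.pF cc.A cc.B cc.C &&
    decide (cubicAtCoords fc.a fc.b fc.c cc.A cc.B cc.C cc.t = (0, 0, 0)) &&
    decide (derivAtCoords fc.a fc.b fc.c cc.A cc.B cc.t =
      MonicCubic.mulCoords fc.a fc.b fc.c cc.D (prodPowCoords fc.a fc.b fc.c [])) &&
    decide (MonicCubic.disc cc.A cc.B cc.C < 0) &&
    decide (normFormZ fc.a fc.b fc.c cc.D.1 cc.D.2.1 cc.D.2.2 ≠ 0) &&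
    decide ((normFormZ fc.a fc.b fc.c cc.D.1 cc.D.2.1 cc.D.2.2).natAbs = (cc.dn.map fun pe => pe.1 ^ pe.2).prod) &&
    (cc.dn.all fun pe => (fc.primes.any fun e => e.p == pe.1) &&
      ((fc.row pe.1).codes.all fun C' => decide (C' ∈ cc.codes) ||
        cc.dinv.any fun ci => ci.1 == C' && invCert fc.a fc.b fc.c C' cc.D ci.2)) &&
    (cc.codes.all fun C => (fc.primes.any fun e => e.p == C.1) && decide (C ∈ (fc.row C.1).codes)) &&
    invCert fc.a fc.b fc.c fc.w₁ cc.D cc.dW1 && invCert fc.a fc.b fc.c fc.w₂ cc.D cc.dW2 &&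
    (cc.Q.all fun q => decide (0 < q)) &&
    ((fam fc cc).all fun f => famCheck fc cc.D f) &&
    decide (∀ T : Finset (Fin (fam fc cc).length), T ≠ ∅ →
      ∃ k : Fin (fc.chars.length + 3), Odd (T.filter fun j => bit fc cc k j = true).card) &&
    killListCheck fc.a fc.b fc.c cc.t.2.1 cc.t.2.2 noUnitCoords (famCoords fc cc) (killEntriesCl fc cc ks) &&
    ((killEntriesCl fc cc ks).all fun e => !(decide (e.T = ∅) && decide (e.U = ∅))) &&
    decide (((Finset.univ ×ˢ Finset.univ).filter
      (fun p : Finset (Fin 0) × Finset (Fin (fam fc cc).length) => admK fc cc ks p.1 p.2 = true)).card <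
        2 ^ (r + 1))

/-! ## Soundness -/

section Sound

variable {K : Type*} [Field K] [NumberField K] {θ : K}

/-- **Soundness of the kill-list checker: `rank E(ℚ) ≤ r`** (the proof of `rank_le_of_checkLe_cl` up to the
sieve, then `admKills_sound` for the killed classes and the strict-count cover theorem with the sieve
`admKills (adm fc cc) kills`). [cite: Cassels1991LecturesEllipticCurves, §15] -/
theorem rank_le_of_checkLeK_cl (r : ℕ) (fc : ClFieldCert) (hθ : aeval θ (MonicCubic.poly fc.a fc.b fc.c) = 0)
    (h3 : finrank ℚ K = 3) (hF : fc.check = true) (hpr : fc.primeList.Forall Nat.Prime) (cc : ClCurveCert)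
    (ks : List ClKill) (hc : checkLeK r fc cc ks = true) :
    ((⟨0, cc.A, 0, cc.B, cc.C⟩ : WeierstrassCurve ℚ)).mordellWeilRank ≤ r := by
  classical
  have hirr := fc.irreducible_of_check hF
  have hq := fc.q_prime hpr
  simp only [checkLeK, Bool.and_eq_true, decide_eq_true_eq, List.all_eq_true, List.any_eq_true,
    Bool.or_eq_true, beq_iff_eq] at hc
  obtain ⟨⟨⟨⟨⟨⟨⟨⟨⟨⟨⟨⟨⟨⟨⟨⟨hΔ, hirrF⟩, hcub⟩, hder⟩, hdisc⟩, hND0⟩, hdn⟩, hdnC⟩, hcodes⟩, hdW1⟩, hdW2⟩, hQ⟩,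
    hfamAll⟩, hcert⟩, hkill⟩, hTU⟩, hcount⟩ := hc
  haveI hE := isElliptic_of_deltaShort_ne hΔ
  have hirrF' := irreducible_of_noRootMod hirrF
  -- `θ_E`, `D`, `M = D·q`
  have haev := aeval_lin_eq_zero_of_coords hθ cc.t hcub
  have hderiv : (3 : 𝓞 K) * (lin hθ cc.t.1 cc.t.2.1 cc.t.2.2) ^ 2 +
      2 * ((cc.A : ℤ) : 𝓞 K) * (lin hθ cc.t.1 cc.t.2.1 cc.t.2.2) + ((cc.B : ℤ) : 𝓞 K) =
        lin hθ cc.D.1 cc.D.2.1 cc.D.2.2 := by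
    simpa using deriv_eq_of_coords hθ cc.t cc.D [] hder
  have hD0 : (lin hθ cc.D.1 cc.D.2.1 cc.D.2.2 : 𝓞 K) ≠ 0 := lin_ne_zero_of_coords hirr hθ h3 _ hND0
  have hq0 : ((fc.q : ℕ) : 𝓞 K) ≠ 0 := by exact_mod_cast hq.ne_zero
  have hM0 : (lin hθ cc.D.1 cc.D.2.1 cc.D.2.2 : 𝓞 K) * ((fc.q : ℕ) : 𝓞 K) ≠ 0 := mul_ne_zero hD0 hq0
  have hgen := closure_tsupp_eq_top_of_dvd
    (dvd_mul_left ((fc.q : ℕ) : 𝓞 K) (lin hθ cc.D.1 cc.D.2.1 cc.D.2.2)) (fc.closure_q_eq_top_of_check hθ h3 hF hpr)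
  have hDM : ∀ v : HeightOneSpectrum (𝓞 K), (3 : 𝓞 K) * (lin hθ cc.t.1 cc.t.2.1 cc.t.2.2) ^ 2 +
      2 * ((cc.A : ℤ) : 𝓞 K) * (lin hθ cc.t.1 cc.t.2.1 cc.t.2.2) + ((cc.B : ℤ) : 𝓞 K) ∈ v.asIdeal →
      (lin hθ cc.D.1 cc.D.2.1 cc.D.2.2 : 𝓞 K) * ((fc.q : ℕ) : 𝓞 K) ∈ v.asIdeal := by
    intro v hv
    rw [hderiv] at hv
    exact Ideal.mul_mem_right _ _ hv
  have hDW₁ : (lin hθ cc.D.1 cc.D.2.1 cc.D.2.2 : 𝓞 K) ∉ (fc.W₁ hθ h3 hF hpr).asIdeal :=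
    lin_not_mem_of_invCert hθ _ (W₁_asIdeal hθ h3 hF hpr) hdW1
  have hDW₂ : (lin hθ cc.D.1 cc.D.2.1 cc.D.2.2 : 𝓞 K) ∉ (fc.W₂ hθ h3 hF hpr).asIdeal :=
    lin_not_mem_of_invCert hθ _ (W₂_asIdeal hθ h3 hF hpr) hdW2
  -- the support `T = {W₁, W₂} ∪ codes`
  set L := cc.codes.length with hL
  let Tf : Fin (L + 2) → HeightOneSpectrum (𝓞 K) := Matrix.vecCons (fc.W₁ hθ h3 hF hpr)
    (Matrix.vecCons (fc.W₂ hθ h3 hF hpr) fun i => codePrime hθ h3 hF hpr (cc.codes.get i))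
  have hT : ∀ w : HeightOneSpectrum (𝓞 K),
      (lin hθ cc.D.1 cc.D.2.1 cc.D.2.2 : 𝓞 K) * ((fc.q : ℕ) : 𝓞 K) ∈ w.asIdeal → ∃ i, Tf i = w := by
    intro w hw
    rcases w.isPrime.mem_or_mem hw with hD | hqw
    · obtain ⟨l, hl, hldvd, hlw⟩ := exists_prime_dvd_norm_mem w hD0 hD
      rw [natAbs_norm_lin_coords hirr hθ h3, hdn] at hldvd
      obtain ⟨a, ha, hla⟩ := (Prime.dvd_prod_iff hl.prime).mp hldvd
      obtain ⟨pe, hpe, rfl⟩ := List.mem_map.mp ha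
      obtain ⟨hany, hrowcodes⟩ := hdnC pe hpe
      have hany' : (fc.primes.any fun e => e.p == pe.1) = true := by simpa [List.any_eq_true] using hany
      obtain ⟨hrow, hrowp⟩ := row_mem hany'
      have hpp : (fc.row pe.1).p.Prime := fc.prime_of_mem hpr hrow
      have hl_eq : l = pe.1 :=
        (Nat.prime_dvd_prime_iff_eq hl (hrowp ▸ hpp)).mp (hl.dvd_of_dvd_pow hla)
      have hlw' : ((fc.row pe.1).p : 𝓞 K) ∈ w.asIdeal := by rw [hrowp, ← hl_eq]; exact hlw
      obtain ⟨C', hC', hw'⟩ :=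
        exists_code_of_natCast_mem hirr hθ h3 hpp (fc.row_check_of_mem hF hrow).1 w hlw'
      rcases hrowcodes C' hC' with hmem | ⟨ci, -, hci, hinv⟩
      · obtain ⟨i, hi⟩ := List.mem_iff_get.mp hmem
        obtain ⟨hc1, hc2⟩ := hcodes _ (List.get_mem _ i)
        have hc1' : (fc.primes.any fun e => e.p == (cc.codes.get i).1) = true := by
          simpa [List.any_eq_true] using hc1
        refine ⟨i.succ.succ, HeightOneSpectrum.ext ?_⟩
        simp only [Tf, Matrix.cons_val_succ]
        rw [codePrime_asIdeal hθ h3 hF hpr hc1' hc2, hi, hw']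
      · exact absurd hD (lin_not_mem_of_invCert hθ w hw' hinv)
    · rcases eq_W₁_or_W₂ hθ h3 hF hpr w hqw with rfl | rfl
      · exact ⟨0, by simp [Tf]⟩
      · exact ⟨1, by simp [Tf]⟩
  -- the family
  set fm := fam fc cc with hfm
  let W : Fin fm.length → 𝓞 K := fun j => lin hθ (fm.get j).2.2.g.1 (fm.get j).2.2.g.2.1 (fm.get j).2.2.g.2.2
  have hfam : ∀ j : Fin fm.length, famCheck fc cc.D (fm.get j) = true := fun j => hfamAll _ (List.get_mem _ j)
  have hW0 : ∀ j, W j ≠ 0 := fun j => lin_ne_zero_of_famCheck hθ h3 hF (hfam j)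
  have hWval : ∀ j (v : HeightOneSpectrum (𝓞 K)),
      (lin hθ cc.D.1 cc.D.2.1 cc.D.2.2 : 𝓞 K) * ((fc.q : ℕ) : 𝓞 K) ∉ v.asIdeal →
        v.valuation K (algebraMap (𝓞 K) K (W j)) = 1 :=
    fun j v hv => valuation_eq_one_of_support _ _ (supp_of_famCheck hθ h3 hF hpr (hfam j)) v hv
  obtain ⟨ρ, hlo, hhi⟩ := fc.exists_rho_of_check hθ h3 hF
  -- independence modulo squares: the parity certificate
  have hind : ∀ S : Finset (Fin fm.length), IsSquare (∏ i ∈ S, algebraMap (𝓞 K) K (W i)) → S = ∅ := by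
    intro S hS
    refine indep_of_parity_certificate (fun i => algebraMap (𝓞 K) K (W i)) (bit fc cc) ?_ hcert S hS
    intro k S' hS'
    have hS'' : IsSquare (∏ i ∈ S', W i) := isSquare_prod_of_isSquare_prod_coe _ hS'
    obtain ⟨k, hk⟩ := k
    rcases k with _ | _ | _ | k
    · have h := even_card_of_isSquare_real ρ (fun i => algebraMap (𝓞 K) K (W i))
        (fun i => rho_ne_zero_of_famCheck hθ ρ hlo hhi hF (hfam i)) hS'
      convert h using 2
      refine Finset.filter_congr (fun i _ => ?_)
      exact sign_iff_of_famCheck hθ ρ hlo hhi hF (hfam i)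
    · exact even_card_of_isSquare_valuation (fc.W₁ hθ h3 hF hpr) W hW0 _
        (fun i => by
          show ((!decide ((2 : ℤ) ∣ famL₁ (fm.get i))) = true ↔ _)
          rw [log_W₁_of_famCheck hθ h3 hF hpr (hfam i)]; simp) hS'
    · exact even_card_of_isSquare_valuation (fc.W₂ hθ h3 hF hpr) W hW0 _
        (fun i => by
          show ((!decide ((2 : ℤ) ∣ famL₂ (fm.get i))) = true ↔ _)
          rw [log_W₂_of_famCheck hθ h3 hF hpr (hfam i)]; simp) hS'
    · have hk' : k < fc.chars.length := by omega
      have hch : fc.chars.getD k ((3 : ℕ), (0 : ℤ), (0 : ℤ)) ∈ fc.chars := by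
        rw [List.getD_eq_getElem?_getD, List.getElem?_eq_getElem hk', Option.getD_some]
        exact List.getElem_mem hk'
      obtain ⟨h2, ψ, hψ⟩ := fc.exists_psi_of_check hθ h3 hF hpr hch
      haveI : Fact (fc.chars.getD k (3, 0, 0)).1.Prime := ⟨fc.char_prime hpr hch⟩
      have h := even_card_filter_eulerBit hθ (ℓ := (fc.chars.getD k (3, 0, 0)).1) (by omega) ψ hψ
        (fun i => (fm.get i).2.2.g) (fun i => not_dvd_evalInt_of_famCheck (hfam i) hch) hS''
      convert h using 2
      exact Finset.filter_congr (fun i _ => Iff.rfl)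
  -- spanning of the `T`-units modulo squares
  have hodd : Odd (finrank ℚ K) := by rw [h3]; decide
  have hn : fm.length = NumberField.Units.rank K + 1 + (L + 2) := by
    rw [fc.units_rank_of_check hθ h3 hF]
    simp only [hfm, fam, List.length_cons, List.length_map, hL]
    omega
  have hspan : ∀ u : K, u ≠ 0 →
      (∀ v : HeightOneSpectrum (𝓞 K),
        (lin hθ cc.D.1 cc.D.2.1 cc.D.2.2 : 𝓞 K) * ((fc.q : ℕ) : 𝓞 K) ∉ v.asIdeal → v.valuation K u = 1) →
      ∃ U : Finset (Fin fm.length), IsSquare (u * ∏ j ∈ U, algebraMap (𝓞 K) K (W j)) :=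
    fun u hu huT => exists_isSquare_tunit_mul_prod hodd _ Tf hT hn (fun j => algebraMap (𝓞 K) K (W j))
      (fun j => RingOfIntegers.coe_ne_zero_iff.mpr (hW0 j)) hWval hind u hu huT
  -- the sieve is sound at rational points
  have hθQ : ∀ x : ℚ, algebraMap ℚ K x ≠ algebraMap (𝓞 K) K (lin hθ cc.t.1 cc.t.2.1 cc.t.2.2) :=
    ne_of_powIndep (powIndep_algebraMap hirrF' haev h3)
  have hFrel : (lin hθ cc.t.1 cc.t.2.1 cc.t.2.2 : 𝓞 K) ^ 3 + cc.A * (lin hθ cc.t.1 cc.t.2.1 cc.t.2.2) ^ 2 +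
      cc.B * (lin hθ cc.t.1 cc.t.2.1 cc.t.2.2) + cc.C = 0 := by
    apply RingOfIntegers.coe_injective
    simpa only [map_add, map_mul, map_pow, map_intCast, _root_.map_zero] using MonicCubic.theta_rel haev
  have hadm0 : adm fc cc ∅ ∅ = true := by
    simp only [adm, Bool.and_eq_true, decide_eq_true_eq, Finset.filter_empty, Finset.card_empty]
    exact ⟨⟨admStdQ_empty _ hQ _ _ _ _, by decide⟩, by decide⟩
  have hadm : ∀ x y : ℚ, y ^ 2 = x ^ 3 + cc.A * x ^ 2 + cc.B * x + cc.C →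
      ∀ (T : Finset (Fin 0)) (U : Finset (Fin fm.length)),
        IsSquare ((algebraMap ℚ K x - algebraMap (𝓞 K) K (lin hθ cc.t.1 cc.t.2.1 cc.t.2.2)) *
          (∏ i ∈ T, algebraMap (𝓞 K) K (((fun i : Fin 0 => i.elim0 : Fin 0 → (𝓞 K)ˣ) i : (𝓞 K)ˣ) : 𝓞 K)) *
            ∏ j ∈ U, algebraMap (𝓞 K) K (W j)) → adm fc cc T U = true := by
    intro x y hxy T U hsq
    have hcof := cofactor_pos_of_disc_neg (rho_theta_root ρ haev) hdisc
    have h1 : admStd (fun i : Fin 0 => i.elim0) (famNorm fc cc) (fun i : Fin 0 => i.elim0) (famSign fc cc) T U =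
        true :=
      admStd_sound hirrF' haev h3 ρ hcof (w := fun i : Fin 0 => algebraMap (𝓞 K) K
          (((fun i : Fin 0 => i.elim0 : Fin 0 → (𝓞 K)ˣ) i : (𝓞 K)ˣ) : 𝓞 K))
        (g := fun j => algebraMap (𝓞 K) K (W j)) (fun i => i.elim0)
        (fun j => RingOfIntegers.coe_ne_zero_iff.mpr (hW0 j)) (fun i => i.elim0)
        (fun j => norm_of_famCheck hθ h3 hF) (fun i => i.elim0)
        (fun j => sign_iff_of_famCheck hθ ρ hlo hhi hF (hfam j)) x y hxy T U hsq
    have h2 := valRow_sound hFrel hθQ (fc.W₁ hθ h3 hF hpr) (by rw [hderiv]; exact hDW₁) hW0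
      (r := fun j => bitRow fc (fm.get j) 1) (fun j => by
        show ((!decide ((2 : ℤ) ∣ famL₁ (fm.get j))) = true ↔ _)
        rw [show algebraMap (𝓞 K) K (W j) = ((W j : 𝓞 K) : K) from rfl,
          log_W₁_of_famCheck hθ h3 hF hpr (hfam j)]; simp) x y hxy T U hsq
    have h3' := valRow_sound hFrel hθQ (fc.W₂ hθ h3 hF hpr) (by rw [hderiv]; exact hDW₂) hW0
      (r := fun j => bitRow fc (fm.get j) 2) (fun j => by
        show ((!decide ((2 : ℤ) ∣ famL₂ (fm.get j))) = true ↔ _)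
        rw [show algebraMap (𝓞 K) K (W j) = ((W j : 𝓞 K) : K) from rfl,
          log_W₂_of_famCheck hθ h3 hF hpr (hfam j)]; simp) x y hxy T U hsq
    simp only [adm, Bool.and_eq_true]
    exact ⟨⟨admStdQ_of_admStd hQ h1, h2⟩, h3'⟩
  -- the killed classes: `admKills_sound` over the family coordinates (no separate units)
  have hadmK : ∀ x y : ℚ, y ^ 2 = x ^ 3 + cc.A * x ^ 2 + cc.B * x + cc.C →
      ∀ (T : Finset (Fin 0)) (U : Finset (Fin fm.length)),
        IsSquare ((algebraMap ℚ K x - algebraMap (𝓞 K) K (lin hθ cc.t.1 cc.t.2.1 cc.t.2.2)) *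
          (∏ i ∈ T, algebraMap (𝓞 K) K (((fun i : Fin 0 => i.elim0 : Fin 0 → (𝓞 K)ˣ) i : (𝓞 K)ˣ) : 𝓞 K)) *
            ∏ j ∈ U, algebraMap (𝓞 K) K (W j)) → admK fc cc ks T U = true := by
    intro x y hxy T U hsq
    exact admKills_sound hirr hθ h3 cc.t.1
      (u := fun i : Fin 0 => (((fun i : Fin 0 => i.elim0 : Fin 0 → (𝓞 K)ˣ) i : (𝓞 K)ˣ) : 𝓞 K)) W
      (cu := noUnitCoords) (cg := famCoords fc cc) (fun i => i.elim0) (fun j => rfl) hkill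
      (hadm x y hxy T U hsq) x hsq
  exact mordellWeilRank_le_of_coverSet_cl_lt (A := cc.A) (B := cc.B) (C := cc.C)
    (⟨0, cc.A, 0, cc.B, cc.C⟩ : WeierstrassCurve ℚ) rfl rfl rfl rfl rfl hirrF' haev h3 hM0 hgen hDM hW0 hspan
    (Wu := fun i : Fin 0 => i.elim0) (adm := admK fc cc ks)
    (admKills_empty hadm0 (List.all_eq_true.mpr hTU)) hadmK (s' := r) hcount

/-- **`rank E(ℚ) = r`** from checked field and kill-list-checked curve records and a tree lower bound
`r ≤ rank`. [cite: CremonaAlgorithms1997, §3.6] -/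
theorem rank_eq_of_checkLeK_cl (r : ℕ) (fc : ClFieldCert) (hθ : aeval θ (MonicCubic.poly fc.a fc.b fc.c) = 0)
    (h3 : finrank ℚ K = 3) (hF : fc.check = true) (hpr : fc.primeList.Forall Nat.Prime) (cc : ClCurveCert)
    (ks : List ClKill) (hc : checkLeK r fc cc ks = true)
    (hlow : r ≤ (((⟨0, cc.A, 0, cc.B, cc.C⟩ : WeierstrassCurve ℤ)).map (Int.castRingHom ℚ)).mordellWeilRank) :
    (((⟨0, cc.A, 0, cc.B, cc.C⟩ : WeierstrassCurve ℤ)).map (Int.castRingHom ℚ)).mordellWeilRank = r := by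
  have hE : ((⟨0, cc.A, 0, cc.B, cc.C⟩ : WeierstrassCurve ℤ)).map (Int.castRingHom ℚ) =
      (⟨0, cc.A, 0, cc.B, cc.C⟩ : WeierstrassCurve ℚ) := by
    ext <;> simp [WeierstrassCurve.map]
  refine le_antisymm ?_ hlow
  rw [hE]
  exact rank_le_of_checkLeK_cl r fc hθ h3 hF hpr cc ks hc

end Sound

/-! ## `K`-free wrappers over the model `CubicField a b c` (the shape of every sharded v2.5 row) -/

/-- **`rank E(ℚ) = r` from the two records and a kill list** (model `(0, A, 0, B, C)`):
`rank_eq_of_certsLeK r <field> ⟨curve⟩ [kills] (by decide +kernel) (by norm_num [ClFieldCert.primeList]) (by decide +kernel) <lower bound>`.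
[cite: Cassels1991LecturesEllipticCurves, §15] [cite: CremonaAlgorithms1997, §3.6] -/
theorem rank_eq_of_certsLeK (r : ℕ) (fc : ClFieldCert) (cc : ClCurveCert) (ks : List ClKill)
    (hF : fc.check = true) (hpr : fc.primeList.Forall Nat.Prime) (hc : checkLeK r fc cc ks = true)
    (hlow : r ≤ (((⟨0, cc.A, 0, cc.B, cc.C⟩ : WeierstrassCurve ℤ)).map (Int.castRingHom ℚ)).mordellWeilRank) :
    (((⟨0, cc.A, 0, cc.B, cc.C⟩ : WeierstrassCurve ℤ)).map (Int.castRingHom ℚ)).mordellWeilRank = r := by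
  haveI : Fact (Irreducible (MonicCubic.polyQ fc.a fc.b fc.c)) := ⟨fc.irreducible_of_check hF⟩
  exact rank_eq_of_checkLeK_cl (K := CubicField fc.a fc.b fc.c) r fc (CubicField.aeval_root fc.a fc.b fc.c)
    (CubicField.finrank_eq fc.a fc.b fc.c) hF hpr cc ks hc hlow

/-- **`rank E(ℚ) = r` for the ORIGINAL model** `(a₁, a₂, a₃, a₄, a₆)` when the records certify its
completed-square model `(0, a₁² + 4a₂, 0, 8(a₁a₃ + 2a₄), 16(a₃² + 4a₆))` (rank is invariant under the
variable change; the model identity is `rank_eq_of_certsLe_complSq`'s). [cite: CremonaAlgorithms1997, §3.6] -/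
theorem rank_eq_of_certsLeK_complSq (r : ℕ) (fc : ClFieldCert) (cc : ClCurveCert) (ks : List ClKill)
    (hF : fc.check = true) (hpr : fc.primeList.Forall Nat.Prime) (hc : checkLeK r fc cc ks = true)
    (a₁ a₂ a₃ a₄ a₆ : ℤ)
    (hABC : cc.A = a₁ ^ 2 + 4 * a₂ ∧ cc.B = 8 * (a₁ * a₃ + 2 * a₄) ∧ cc.C = 16 * (a₃ ^ 2 + 4 * a₆))
    (hlow : r ≤ (((⟨a₁, a₂, a₃, a₄, a₆⟩ : WeierstrassCurve ℤ)).map (Int.castRingHom ℚ)).mordellWeilRank) :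
    (((⟨a₁, a₂, a₃, a₄, a₆⟩ : WeierstrassCurve ℤ)).map (Int.castRingHom ℚ)).mordellWeilRank = r := by
  obtain ⟨hA, hB, hC⟩ := hABC
  have hV : ((⟨0, cc.A, 0, cc.B, cc.C⟩ : WeierstrassCurve ℤ)).map (Int.castRingHom ℚ) =
      (⟨Units.mk0 (1 / 2 : ℚ) (by norm_num), 0, -(a₁ : ℚ) / 2, -(a₃ : ℚ) / 2⟩ :
        WeierstrassCurve.VariableChange ℚ) •
        (((⟨a₁, a₂, a₃, a₄, a₆⟩ : WeierstrassCurve ℤ)).map (Int.castRingHom ℚ)) := by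
    ext <;> simp only [WeierstrassCurve.map_a₁, WeierstrassCurve.map_a₂, WeierstrassCurve.map_a₃,
      WeierstrassCurve.map_a₄, WeierstrassCurve.map_a₆, WeierstrassCurve.variableChange_a₁,
      WeierstrassCurve.variableChange_a₂, WeierstrassCurve.variableChange_a₃,
      WeierstrassCurve.variableChange_a₄, WeierstrassCurve.variableChange_a₆, Units.val_inv_eq_inv_val,
      Units.val_mk0, hA, hB, hC, eq_intCast, Int.cast_zero] <;> push_cast <;> ring
  have hr : (((⟨0, cc.A, 0, cc.B, cc.C⟩ : WeierstrassCurve ℤ)).map (Int.castRingHom ℚ)).mordellWeilRank =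
      (((⟨a₁, a₂, a₃, a₄, a₆⟩ : WeierstrassCurve ℤ)).map (Int.castRingHom ℚ)).mordellWeilRank := by
    rw [hV]; exact WeierstrassCurve.mordellWeilRank_variableChange_holds _ _
  rw [← hr] at hlow ⊢
  exact rank_eq_of_certsLeK r fc cc ks hF hpr hc hlow

/-! ## Kernel sanity checks -/

/-- The landed `4528a1` field record (`−283`; the literal of `Rank2Observatory2DescClRowCertLe`). -/
private def m283k : ClFieldCert :=
  ⟨0, 4, -1, 7, 123/500, 247/1000, 5, 19, (3, 3, 13), (2, 0, 0), [(3, 2, 1), (5, 2, 2), (31, 24, 8)],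
    ⟨(0, 0, 0), (-4, 0, -1), true, (0, -1, 0), 0, 0, (0, 0, 0), []⟩,
    ⟨(0, 0, 0), (10, 0, 1), false, (36, 1, -6), 2, 2, (-9, 6, -3), []⟩,
    [⟨2, 1, (1, 1, 1), (0, 2, 0), [(3, -1, 0, 1), (7, 1, 1, 1)],
       [⟨(1, 1, 1), (7, 1, 1), false, (6, -3, -1), 1, 1, (0, -8, 0), [(1, 0, 0)]⟩]⟩,
     ⟨3, 1, (2, 2, 2), (1, 2, 0), [(1, 0, 2, 1)], []⟩,
     ⟨283, 0, (248, 248, 70), (15213, -340, 2), [],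
       [⟨(-248, 1, 0), (-4, 0, -3), true, (-1216, -171, -456), 1, 0, (9, -3, 0), [(118, 0, 0)]⟩]⟩]⟩

/-- The landed `4528a1` curve record (`4` admissible classes). -/
private def c4528a1k : ClCurveCert :=
  ⟨1, -4, 12, 7, (-3, -1, -1), (23, -5, 7), [(2, 4), (283, 1)], [(2, 1, 1, 1), (283, -248, 1, 0)],
    [((2, -1, 1, 0), (1, 0, 0)), ((283, -70, 1, 0), (196, 0, 0))], (15, 0, 0), (17, 10, 0), [8]⟩

/-- With an empty kill list the checker is `checkLe` plus two trivially true clauses. -/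
example : checkLeK 2 m283k c4528a1k [] = true := by decide +kernel

example : checkLeK 1 m283k c4528a1k [] = false := by decide +kernel

end Summit.BirchSwinnertonDyer.BirchSwinnertonDyer.Rank2Observatory.TwoDescCl

end
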